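import Summits.BirchSwinnertonDyer.BirchSwinnertonDyer.Theorems.GenusKolyvaginAtTwoGenusPrimitiveSupplyAtTwoTwistSelmerTransferUp
import Literature.NumberTheory.EllipticCurves.MazurRubin2010.TwistSelmerParity
import HarnessLib

/-!
# Route `GenusKolyvaginAtTwo`, crux #2 `GenusPrimitiveSupplyAtTwo` (stmt-BirchSwinnertonDyer-22136):
# Mazur–Rubin Cor. 3.4 (i), UP direction, for the quadratic-twist pair — over every number field from the place menu,
# and the `ℚ`-instance for the prime Heegner twin — modulo Poitou–Tate, Tate's χ and Kramer's congruence BY NAME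

Width seat `bsd-line-gk2-p5` g9 (cell `bsd-f1-sign2`, SUPPLY lineage), file 15 of the series (crux workfile
`Lines/genus-supply-mr-instantiation.md`). THEOREMS ONLY (no definition, no named fact introduced here, no `sorry`); helper
`--supports stmt-BirchSwinnertonDyer-22136`; no item is closed; BSD is not proved by any of this.

WHAT. The companion file `…TwistSelmerTransferUp.lean` (p628794) proved the UP transfer with the parity of the pair DISPLAYED.
Here that parity is taken from the Literature named fact `MazurRubin2010.kramerParity K` (Mazur–Rubin 2010 Thm. 2.7 = Kramer 1981
Thms 1–2 with Lemma 2.9, statement-only, `MazurRubin2010/TwistSelmerParity.lean`), whose identification hypothesis `huniq` is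
discharged by `ρ̄_{W,2}` onto (`intertwining_apply_eq_of_hasSurjectiveModNGaloisRep_two`):

* §35 `natCard_selmerGroup_twist_eq_mul_two_of_places_of_parity` — `W` elliptic over a number field `K` with `ρ̄_{W,2}` onto, good
  at a finite `v₀ ∤ 2`, `d` a non-square with `v₀(d)` odd, `Wd` ANY elliptic model of `W^{(d)}`; the lead's place menu off `v₀`
  (split ∨ both good `∤ 2` ∨ silent; split ∨ `H¹ = 0` at `∞`), `#W(K_{v₀})[2] = 2`, and `Sel₂(W)` STRICT at `v₀` ⟹
  **`#Sel₂(Wd) = #Sel₂(W) · 2`**, modulo {`poitouTate_selmerStructure_duality_real K`, `localEulerPoincareCharacteristic`,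
  `MazurRubin2010.kramerParity K`} — NO intertwining data, NO transversality in the hypotheses (gk2-p5 `exists_intertwining_hsplit`,
  lead's Lemma 2.11 `map_kummerLocalConditionAt_inf_eq_bot_of_twist_ramified`). The UP twin of the lead's DOWN
  `GenusKolyTwistRamified.natCard_selmerGroup_twist_mul_two_eq_of_places`.
* §36 `natCard_selmerGroup_twin_eq_two_mul_of_le_strictLocalKer_of_parity` — the `ℚ`-INSTANCE in the capstones' currency (twin of
  g8's `natCard_selmerGroup_eq_two_mul_of_not_le_strictLocalKer`, p624297): `W/ℚ` globally minimal, `ρ̄_{W,2}` onto, `Δ_W < 0`, `K` imaginary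
  quadratic with `d_K = −ℓ` odd, Heegner for `N_W`, `2` split, `Wd` any elliptic model of `W^{(d_K)}`,
  `Sel₂(W) ≤ MazurRubin2010.strictLocalKer W ℚ_ℓ 2` ⟹ **`#Sel₂(Wd) = 2 · #Sel₂(W)`**. A SECOND, INDEPENDENT proof of the statement gk2-p4 g9
  landed first as `natCard_selmerGroup_twin_eq_two_mul_of_le_strictLocalKer` (p628133, `…TwistSelmerStrictUp.lean`, via GLOBAL parity: 2-parity
  theorem + Cassels–Tate + modularity/root numbers, `ℚ` only): here the parity is LOCAL (Kramer's congruence), so no modularity, no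
  Dokchitser–Dokchitser and no Cassels–Tate enter, and the number-field form §35 has no `ℚ`-analogue there.
* §37 `cor34i_twin_prime_heegner_of_duality_of_parity` (BOTH halves of `GenusKolyTwin.cor34i_twin_prime_heegner` with
  `h34 : cor34i_singleton_rat` replaced by {PT, Tate χ, Kramer parity} + `ρ̄₂` onto), `natCard_selmerGroup_twin_eq_two_of_parity`
  (`#Sel₂(W) = 1` ⟹ the prime Heegner twin is `Sel₂`-minimal — the DEF = 1 SUPPLY on the `Ш(E)[2] = 0` rows, formerly mod
  `prop33_rat` / `cor34i`), `natCard_selmerGroup_twin_eq_two_iff_not_strict_of_duality_of_parity` (`#Sel₂(W) = 4` rows).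

NET: `MazurRubin2010.cor34i_singleton_rat` and `prop33_rat` are no longer load-bearing in ANY consumer of the cell, in either direction,
on EITHER print basis: {Poitou–Tate (Milne I.4.10 + real places), Tate's local Euler characteristic (Milne I.2.8), Kramer's congruence
(MR10 Thm. 2.7)} (this file) or {Poitou–Tate, Tate χ, 2-parity, Cassels–Tate, modularity} (gk2-p4 p628133) — all statement-level facts.
References: [MazurRubin2010] Thm. 2.7, Lemmas 2.9–2.11, Def. 3.1, Prop. 3.3, Cor. 3.4 (i); [Kramer1981] Thms 1–2, Prop. 7;
[MilneADT2006] I Thm. 2.8, Lemma 3.3, Thm. 4.10; [GrossLMS1991] §1, §9.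
-/

set_option linter.dupNamespace false -- tree convention: `Summit.BirchSwinnertonDyer.BirchSwinnertonDyer.Theorems` (summit = sub-problem)
set_option autoImplicit false

noncomputable section

open scoped Classical ContRepresentation

namespace Summit.BirchSwinnertonDyer.BirchSwinnertonDyer.Theorems.GenusKolyTwistLocal

open WeierstrassCurve Field NumberField IsDedekindDomain Function
open Literature.NumberTheory.EllipticCurves Literature.NumberTheory.GaloisRepresentations
open Literature.NumberTheory.GaloisRepresentations.DiscreteGaloisModule (SelmerStructure)
open Literature.NumberTheory.GaloisCohomology
open Summit.BirchSwinnertonDyer.Rank1Residual.X11b.CongruentTransfer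
open Rat.HeightOneSpectrum (primesEquiv natGenerator)

/-! ## §35 UP for the twist pair over a number field, from the place menu, modulo {PT, Tate χ, Kramer parity} -/

section Places

variable {K : Type} [Field K] [NumberField K] (W : WeierstrassCurve K) [W.IsElliptic]

/-- **Mazur–Rubin Cor. 3.4 (i), UP direction, for the quadratic-twist pair `(E, E^{(d)})` at `p = 2` — NO intertwining data and NO
transversality in the hypotheses.** For `W` elliptic over a number field `K` with `ρ̄_{W,2}` onto and good reduction at a finite
`v₀ ∤ 2`, `d` a NON-SQUARE with `v₀(d)` odd (`d = c² π`, `π` a uniformiser at `v₀`), and ANY elliptic model `Wd` of `W^{(d)}`: IF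
every finite `v ≠ v₀` is split (`d ∈ (K_v^×)²`) or good for both curves with `v ∤ 2` or silent (`v ∤ 2`, no `K_v`-rational `2`-torsion
on either curve), every infinite place is split or has `H¹(K_w, ·) = 0` for both curves, `#W(K_{v₀})[2] = 2`, and EVERY class of
`Sel₂(W)` has zero localisation at `v₀` (STRICT), THEN `#Sel₂(Wd) = #Sel₂(W) · 2` — granted the three print facts
`poitouTate_selmerStructure_duality_real K` (Milne ADT I.4.10 + real places), `localEulerPoincareCharacteristic` (Tate) and
`MazurRubin2010.kramerParity K` (Mazur–Rubin Thm. 2.7 = Kramer's congruence). The intertwining pair and the split-place agreement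
come from gk2-p5's `exists_intertwining_hsplit` (Lemma 2.10 (i)); it IS the printed identification `E^F[2] = E[2]` by §33 (`ρ̄₂`
onto); the transversality at `v₀` is the lead's Lemma 2.11; the index-`2` sandwich and the parity exclusion are §32.
[cite: MazurRubin2010, Thm. 2.7, Lemmas 2.9–2.11, Prop. 3.3, Cor. 3.4 (i) (DASH copy pp. 6–9)]
[cite: MilneADT2006, Ch. I, Thm. 2.8, Lemma 3.3 and Thm. 4.10] -/
theorem natCard_selmerGroup_twist_eq_mul_two_of_places_of_parity
    (hPT : poitouTate_selmerStructure_duality_real K)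
    (hEP : ∀ v : HeightOneSpectrum (𝓞 K), localEulerPoincareCharacteristic (v.adicCompletion K))
    (hKP : MazurRubin2010.kramerParity K) (hsurj : W.HasSurjectiveModNGaloisRep 2)
    {d : K} (hdsq : ∀ x : K, x ^ 2 ≠ d) {Wd : WeierstrassCurve K} [Wd.IsElliptic] {C : VariableChange K}
    (hWd : C • W.quadraticTwist d = Wd)
    (v₀ : HeightOneSpectrum (𝓞 K)) (hv₀ : ((2 : ℕ) : 𝓞 K) ∉ v₀.asIdeal) (hW : W.HasGoodReductionAt v₀)
    (hram : ∃ π c : K, v₀.valuation K π = WithZero.exp (-1 : ℤ) ∧ d = c ^ 2 * π)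
    (hfin : ∀ v : HeightOneSpectrum (𝓞 K), v ≠ v₀ →
      (∃ s : v.adicCompletion K, s ^ 2 = algebraMap K (v.adicCompletion K) d) ∨
      (((2 : ℕ) : 𝓞 K) ∉ v.asIdeal ∧ W.HasGoodReductionAt v ∧ Wd.HasGoodReductionAt v) ∨
      (((2 : ℕ) : 𝓞 K) ∉ v.asIdeal ∧
        Nat.card (nsmulAddMonoidHom 2 : (W.baseChange (v.adicCompletion K)).toAffine.Point →+ _).ker = 1 ∧
        Nat.card (nsmulAddMonoidHom 2 : (Wd.baseChange (v.adicCompletion K)).toAffine.Point →+ _).ker = 1))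
    (hinf : ∀ w : InfinitePlace K,
      (∃ s : w.Completion, s ^ 2 = algebraMap K w.Completion d) ∨
      ((∀ x : galoisCohomology (W.localGaloisModule w.Completion) 1, x = 0) ∧
        (∀ x : galoisCohomology (Wd.localGaloisModule w.Completion) 1, x = 0)))
    (ht : Nat.card (nsmulAddMonoidHom 2 : (W.baseChange (v₀.adicCompletion K)).toAffine.Point →+ _).ker = 2)
    (hstrict : ∀ c ∈ (W.kummerSelmerStructure ((2 : ℕ) : ℤ)).selmerGroup,
      galoisCohomology.localization (W.torsionGaloisModule ((2 : ℕ) : ℤ)) (Sum.inr v₀) 1 c = 0) :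
    Nat.card (Wd.selmerGroup ((2 : ℕ) : ℤ)) = Nat.card (W.selmerGroup ((2 : ℕ) : ℤ)) * 2 := by
  haveI : NeZero (2 : K) := ⟨two_ne_zero⟩
  haveI : Fact (Nat.Prime 2) := ⟨Nat.prime_two⟩
  have hd : d ≠ 0 := fun h ↦ hdsq 0 (by rw [h]; ring)
  obtain ⟨φ, ψ, hψφ, hφψ, hsplit⟩ := exists_intertwining_hsplit W hd hWd
  -- the transported Kummer structure of `Wd`
  let 𝓐 : SelmerStructure (W.torsionGaloisModule ((2 : ℕ) : ℤ)) := fun v ↦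
    (Wd.kummerSelmerStructure ((2 : ℕ) : ℤ) v).map
      (galoisCohomology.map (φ.restrictField (Place.Completion v)) 1)
  have h𝓐 : ∀ v, 𝓐 v = (Wd.kummerSelmerStructure ((2 : ℕ) : ℤ) v).map
      (galoisCohomology.map (φ.restrictField (Place.Completion v)) 1) := fun _ ↦ rfl
  -- agreement at every place other than `v₀` (the place menu, as in `natCard_selmerGroup_twist_mul_two_eq_of_local`)
  have hagree : ∀ v : Place K, v ≠ Sum.inr v₀ → 𝓐 v = W.kummerSelmerStructure ((2 : ℕ) : ℤ) v := by
    rintro (w | v) hv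
    · rcases hinf w with ⟨s, hs⟩ | ⟨hW', hWd'⟩
      · rw [h𝓐, kummerSelmerStructure_apply, kummerSelmerStructure_apply]
        exact hsplit (Place.Completion (Sum.inl w)) ⟨s, hs⟩
      · rw [h𝓐, kummerSelmerStructure_apply, kummerSelmerStructure_apply]
        exact map_kummerLocalConditionAt_eq_of_eq_top W Wd ((2 : ℕ) : ℤ) (Place.Completion (Sum.inl w)) φ ψ hφψ
          (kummerLocalConditionAt_eq_top_of_forall_eq_zero Wd _ _ hWd')
          (kummerLocalConditionAt_eq_top_of_forall_eq_zero W _ _ hW')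
    · have hvv₀ : v ≠ v₀ := fun h ↦ hv (by rw [h])
      rcases hfin v hvv₀ with ⟨s, hs⟩ | ⟨h2v, hvW, hvWd⟩ | ⟨h2v, h1W, h1Wd⟩
      · rw [h𝓐, kummerSelmerStructure_apply, kummerSelmerStructure_apply]
        exact hsplit (Place.Completion (Sum.inr v)) ⟨s, hs⟩
      · exact transport_kummer_inr_eq_of_good W Wd 2 φ ψ hφψ 𝓐 h𝓐 h2v hvW hvWd
      · rw [h𝓐, kummerSelmerStructure_apply, kummerSelmerStructure_apply]
        exact map_kummerLocalConditionAt_adicCompletion_eq_of_natCard_ker_eq_one W Wd v two_ne_zero h2v h1W h1Wd φ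
  -- transversality at `v₀` (the lead's Lemma 2.11)
  have htr : 𝓐 (Sum.inr v₀) ⊓ W.kummerSelmerStructure ((2 : ℕ) : ℤ) (Sum.inr v₀) = ⊥ := by
    rw [h𝓐, kummerSelmerStructure_apply, kummerSelmerStructure_apply]
    exact GenusKolyTwistRamified.map_kummerLocalConditionAt_inf_eq_bot_of_twist_ramified W hd hWd v₀ hv₀ hW hram φ ψ hψφ
  -- the parity of the pair: Kramer's congruence, the intertwining being THE identification (`ρ̄₂` onto)
  have hpar : IsSquare (Nat.card (Wd.selmerGroup ((2 : ℕ) : ℤ)) * Nat.card (W.selmerGroup ((2 : ℕ) : ℤ)) *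
      (𝓐 (Sum.inr v₀)).relIndex (W.kummerSelmerStructure ((2 : ℕ) : ℤ) (Sum.inr v₀))) := by
    have hS : ∀ v ∉ ({(Sum.inr v₀ : Place K)} : Finset (Place K)), 𝓐 v = W.kummerSelmerStructure ((2 : ℕ) : ℤ) v :=
      fun v hv ↦ hagree v (by simpa using hv)
    have h := hKP W d hdsq Wd ⟨C⁻¹, by rw [← hWd, inv_smul_smul]⟩ φ (Function.LeftInverse.injective hψφ)
      (intertwining_apply_eq_of_hasSurjectiveModNGaloisRep_two W Wd hsurj φ ψ hψφ hφψ) 𝓐 h𝓐 {(Sum.inr v₀ : Place K)} hS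
    rwa [Finset.prod_singleton] at h
  refine natCard_selmerGroup_eq_mul_of_transverse_of_forall_localization_eq_zero W Wd 2 hPT hEP φ ψ hψφ hφψ 𝓐 h𝓐 v₀
    hagree htr ?_ hstrict hpar
  -- `t_{v₀} = 2`
  rw [ht, natCard_quotient_span_natCast_eq_one_of_not_mem v₀ hv₀, mul_one]

end Places

/-! ## §36 The `ℚ`-instance for the prime Heegner twin, in the capstones' currency -/

section Rat

variable (W : WeierstrassCurve ℚ)

/-- The discriminant of an imaginary quadratic field with `d_K = −ℓ` is not a square in `ℚ` (it is negative). [folklore] -/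
theorem forall_sq_ne_discr_of_discr_eq_neg {K : Type} [Field K] [NumberField K] {ℓ : ℕ} (hℓ : ℓ.Prime)
    (hd : discr K = -(ℓ : ℤ)) : ∀ x : ℚ, x ^ 2 ≠ (discr K : ℚ) := by
  intro x hx
  have h0 : (0 : ℚ) < ℓ := by exact_mod_cast hℓ.pos
  have h1 : (discr K : ℚ) = -(ℓ : ℚ) := by rw [hd]; push_cast; ring
  have h2 := sq_nonneg x
  rw [hx, h1] at h2
  linarith

/-- **MAZUR–RUBIN COR. 3.4 (i), UP DIRECTION, FOR THE PRIME HEEGNER TWIN — KERNEL THEOREM modulo Poitou–Tate duality, Tate's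
local Euler characteristic and Kramer's congruence BY NAME** (the UP half of the print named fact `MazurRubin2010.cor34i_singleton_rat`
as consumed by `GenusKolyTwin.cor34i_twin_prime_heegner`, same currency; companion of g8's DOWN
`natCard_selmerGroup_eq_two_mul_of_not_le_strictLocalKer` and of gk2-p4's unconditional `natCard_selmerGroup_dvd_twin_of_le_strictLocalKer`).
Let `W/ℚ` be globally minimal elliptic with `ρ̄_{W,2}` onto and `Δ_W < 0`, `K` imaginary quadratic with `d_K = −ℓ` odd (`ℓ` prime),
Heegner for `N_W`, `2` split in `K`, `Wd` an elliptic model of `W^{(d_K)}`. IF `Sel₂(W)` IS strict at `ℓ`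
(`Sel₂(W) ≤ MazurRubin2010.strictLocalKer W ℚ_ℓ 2`), THEN `#Sel₂(Wd) = 2 · #Sel₂(W)`. CONDITIONAL on the displayed hypotheses
`hPT` (Milne I Thm. 4.10), `hEP` (Milne I Thm. 2.8) and `hKP : MazurRubin2010.kramerParity ℚ` (Mazur–Rubin Thm. 2.7) ONLY — a second,
independent proof of gk2-p4's `natCard_selmerGroup_twin_eq_two_mul_of_le_strictLocalKer` (p628133; there modulo {PT, Tate χ, 2-parity,
Cassels–Tate, modularity}); same conclusion, LOCAL parity instead of global root numbers.
[cite: MazurRubin2010, Thm. 2.7, Prop. 3.3, Cor. 3.4 (i), Lemmas 2.9–2.11] [cite: MilneADT2006, I Thm. 2.8, I Thm. 4.10]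
[cite: GrossLMS1991, §1 (p. 235)] -/
theorem natCard_selmerGroup_twin_eq_two_mul_of_le_strictLocalKer_of_parity [W.IsElliptic] [W.IsGloballyMinimal]
    {K : Type} [Field K] [NumberField K]
    (hPT : poitouTate_selmerStructure_duality_real ℚ)
    (hEP : ∀ v : HeightOneSpectrum (𝓞 ℚ), localEulerPoincareCharacteristic (v.adicCompletion ℚ))
    (hKP : MazurRubin2010.kramerParity ℚ) (hsurj : W.HasSurjectiveModNGaloisRep 2)
    (hΔ : W.Δ < 0) (hK : IsImaginaryQuadratic K) (hodd : Odd (discr K))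
    (hH : SatisfiesHeegnerHypothesis (W.conductorNorm ℤ) K) (h2K : ((Ideal.span {(2 : ℤ)}).primesOver (𝓞 K)).ncard = 2)
    {ℓ : ℕ} [Fact ℓ.Prime] (hd : discr K = -(ℓ : ℤ)) (Wd : WeierstrassCurve ℚ) [Wd.IsElliptic]
    (hWd : ∃ C : VariableChange ℚ, C • W.quadraticTwist (discr K : ℚ) = Wd)
    (hs : W.selmerGroup 2 ≤ MazurRubin2010.strictLocalKer W ℚ_[ℓ] 2) :
    Nat.card (Wd.selmerGroup 2) = 2 * Nat.card (W.selmerGroup 2) := by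
  have hℓ : ℓ.Prime := Fact.out
  obtain ⟨hℓ2, hℓN, -⟩ := GenusKolyTwin.prime_discr_facts W hK hodd hH hℓ hd
  -- the place `v₀` of `ℚ` over `ℓ`
  obtain ⟨v₀, hv₀⟩ : ∃ v : HeightOneSpectrum (𝓞 ℚ), ((primesEquiv v : Nat.Primes) : ℕ) = ℓ :=
    ⟨primesEquiv.symm ⟨ℓ, hℓ⟩, by rw [Equiv.apply_symm_apply]⟩
  have hℓv₀ : (ℓ : 𝓞 ℚ) ∈ v₀.asIdeal := by
    rw [← hv₀]
    exact Rat.HeightOneSpectrum.natCast_natGenerator_mem v₀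
  obtain ⟨C, hC⟩ := hWd
  have hd0 : (discr K : ℚ) ≠ 0 := by
    rw [hd]
    push_cast
    exact neg_ne_zero.mpr (by exact_mod_cast hℓ.ne_zero)
  -- `W` good at `v₀`, `v₀ ∤ 2`
  have hW : W.HasGoodReductionAt v₀ := by
    by_contra h
    exact hℓN (hv₀ ▸ (W.dvd_conductorNorm_iff v₀).mpr h)
  have h2v₀ : ((2 : ℕ) : 𝓞 ℚ) ∉ v₀.asIdeal :=
    GenusKolyTwistingPrime.natCast_not_mem_of_not_dvd hℓ hℓv₀ fun h ↦
      hℓ2 ((Nat.prime_dvd_prime_iff_eq hℓ Nat.prime_two).mp h)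
  -- `v₀(d_K) = 1`
  have hram : ∃ π c : ℚ, v₀.valuation ℚ π = WithZero.exp (-1 : ℤ) ∧ (discr K : ℚ) = c ^ 2 * π :=
    ⟨(discr K : ℚ), 1, by
      rw [hd]
      push_cast
      exact GenusKolyTwistRamified.valuation_neg_natCast_eq_exp_neg_one_of_mem v₀ hℓ hℓv₀,
      by rw [one_pow, one_mul]⟩
  -- `#W(ℚ_{v₀})[2] = 2`
  have ht : Nat.card (nsmulAddMonoidHom 2 :
      (W.baseChange (v₀.adicCompletion ℚ)).toAffine.Point →+ _).ker = 2 := by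
    rw [natCard_ker_nsmul_adicCompletion_eq_padic W v₀ 2]
    subst hv₀
    exact GenusKolyTwin.natCard_twoTorsion_padic_eq_two_of_discr_eq_neg_prime W hK hodd hH hd hΔ
  -- strictness in the localisation currency (gk2-p4)
  have hstrict : ∀ c ∈ (W.kummerSelmerStructure ((2 : ℕ) : ℤ)).selmerGroup,
      galoisCohomology.localization (W.torsionGaloisModule ((2 : ℕ) : ℤ)) (Sum.inr v₀) 1 c = 0 := by
    apply forall_selmer_localization_eq_zero_of_le_strictLocalKer W v₀
    subst hv₀
    exact hs
  have h := natCard_selmerGroup_twist_eq_mul_two_of_places_of_parity W hPT hEP hKP hsurj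
    (forall_sq_ne_discr_of_discr_eq_neg hℓ hd) hC v₀ h2v₀ hW hram
    (twist_place_menu_finite_rat W hK.1 hH h2K hℓ hd hℓv₀ hC) (twist_place_menu_infinite_rat W hΔ hd0 hC) ht hstrict
  change Nat.card (Wd.selmerGroup 2) = Nat.card (W.selmerGroup 2) * 2 at h
  omega

end Rat

end Summit.BirchSwinnertonDyer.BirchSwinnertonDyer.Theorems.GenusKolyTwistLocal

/-! ## §37 The `cor34i` consumers of the cell, with `cor34i_singleton_rat` replaced by {PT, Tate χ, Kramer parity} -/

namespace Summit.BirchSwinnertonDyer.BirchSwinnertonDyer.Theorems.GenusKolyTwin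

open WeierstrassCurve NumberField IsDedekindDomain
open Literature.NumberTheory.EllipticCurves Literature.NumberTheory.GaloisRepresentations Literature.NumberTheory.GaloisCohomology
open Summit.BirchSwinnertonDyer.BirchSwinnertonDyer.Theorems.GenusKolyTwistLocal
  (natCard_selmerGroup_eq_two_mul_of_not_le_strictLocalKer natCard_selmerGroup_twin_eq_two_mul_of_le_strictLocalKer_of_parity)

variable (W : WeierstrassCurve ℚ) [W.IsElliptic] [W.IsGloballyMinimal] {K : Type} [Field K] [NumberField K]

/-- **`GenusKolyTwin.cor34i_twin_prime_heegner` with `h34 : cor34i_singleton_rat` REPLACED by Poitou–Tate duality, Tate's local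
Euler characteristic and Kramer's congruence** (and `ρ̄_{W,2}` onto, which makes the intertwining THE identification): at the
prime `ℓ` of a prime Heegner field (`Δ_W < 0`, `d_K = −ℓ` odd, `2` split), for every elliptic model `Wd ≅ W^{(−ℓ)}`: `Sel₂(W)`
STRICT at `ℓ` ⟹ `#Sel₂(Wd) = 2·#Sel₂(W)` (§36), NOT strict ⟹ `#Sel₂(W) = 2·#Sel₂(Wd)` (g8, p624297).
[cite: MazurRubin2010, Cor. 3.4 (i) with Thm. 2.7, Def. 3.1 and Lemma 2.2 (i)] [cite: MilneADT2006, I Thm. 2.8, I Thm. 4.10] -/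
theorem cor34i_twin_prime_heegner_of_duality_of_parity
    (hPT : poitouTate_selmerStructure_duality_real ℚ)
    (hEP : ∀ v : HeightOneSpectrum (𝓞 ℚ), localEulerPoincareCharacteristic (v.adicCompletion ℚ))
    (hKP : MazurRubin2010.kramerParity ℚ) (hsurj : W.HasSurjectiveModNGaloisRep 2)
    (hΔ : W.Δ < 0) (hK : IsImaginaryQuadratic K) (hodd : Odd (discr K))
    (hH : SatisfiesHeegnerHypothesis (W.conductorNorm ℤ) K) (h2K : ((Ideal.span {(2 : ℤ)}).primesOver (𝓞 K)).ncard = 2)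
    {ℓ : ℕ} [Fact ℓ.Prime] (hd : discr K = -(ℓ : ℤ)) (Wd : WeierstrassCurve ℚ) [Wd.IsElliptic]
    (hWd : ∃ C : VariableChange ℚ, C • W.quadraticTwist (discr K : ℚ) = Wd) :
    (W.selmerGroup 2 ≤ MazurRubin2010.strictLocalKer W ℚ_[ℓ] 2 →
        Nat.card (Wd.selmerGroup 2) = 2 * Nat.card (W.selmerGroup 2)) ∧
      (¬ W.selmerGroup 2 ≤ MazurRubin2010.strictLocalKer W ℚ_[ℓ] 2 →
        Nat.card (W.selmerGroup 2) = 2 * Nat.card (Wd.selmerGroup 2)) :=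
  ⟨fun hs ↦ natCard_selmerGroup_twin_eq_two_mul_of_le_strictLocalKer_of_parity W hPT hEP hKP hsurj hΔ hK hodd hH h2K hd Wd hWd hs,
    fun hns ↦ natCard_selmerGroup_eq_two_mul_of_not_le_strictLocalKer W hPT hEP hΔ hK hodd hH h2K hd Wd hWd hns⟩

/-- **On `#Sel₂(W) = 1` the prime Heegner twin is `Sel₂`-minimal** — the DEF = 1 SUPPLY on the `Ш(E)[2] = 0` rows of the habitat
(`GenusKolyTwin.natCard_selmerGroup_twin_eq_two_of_cor34i` / `…_of_prime_heegner` with the MR2010 named facts `cor34i_singleton_rat` /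
`prop33_rat` replaced by {PT, Tate χ, Kramer parity}): the trivial Selmer group is strict at every place, so `d₂` goes UP by one:
`#Sel₂(Wd) = 2` for every elliptic model `Wd` of `W^{(−ℓ)}`, every prime Heegner field `ℚ(√−ℓ)` with `2` split.
[cite: MazurRubin2010, Cor. 3.4 (i) with Thm. 2.7] [cite: MilneADT2006, I Thm. 4.10] -/
theorem natCard_selmerGroup_twin_eq_two_of_parity
    (hPT : poitouTate_selmerStructure_duality_real ℚ)
    (hEP : ∀ v : HeightOneSpectrum (𝓞 ℚ), localEulerPoincareCharacteristic (v.adicCompletion ℚ))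
    (hKP : MazurRubin2010.kramerParity ℚ) (hsurj : W.HasSurjectiveModNGaloisRep 2)
    (hΔ : W.Δ < 0) (hK : IsImaginaryQuadratic K) (hodd : Odd (discr K))
    (hH : SatisfiesHeegnerHypothesis (W.conductorNorm ℤ) K) (h2K : ((Ideal.span {(2 : ℤ)}).primesOver (𝓞 K)).ncard = 2)
    {ℓ : ℕ} [Fact ℓ.Prime] (hd : discr K = -(ℓ : ℤ)) (Wd : WeierstrassCurve ℚ) [Wd.IsElliptic]
    (hWd : ∃ C : VariableChange ℚ, C • W.quadraticTwist (discr K : ℚ) = Wd)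
    (h1 : Nat.card (W.selmerGroup 2) = 1) : Nat.card (Wd.selmerGroup 2) = 2 := by
  have hbot : W.selmerGroup 2 = ⊥ := AddSubgroup.eq_bot_of_card_eq (W.selmerGroup 2) h1
  have h := natCard_selmerGroup_twin_eq_two_mul_of_le_strictLocalKer_of_parity W hPT hEP hKP hsurj hΔ hK hodd hH h2K hd Wd hWd
    (by rw [hbot]; exact bot_le)
  rw [h1, mul_one] at h
  exact h

/-- **On the `#Sel₂(W) = 4` cells the prime Heegner twin is `Sel₂`-minimal iff `Sel₂(W)` is NOT strict at `ℓ`**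
(`GenusKolyTwin.natCard_selmerGroup_twin_eq_two_iff_not_strict` with `cor34i_singleton_rat` replaced by {PT, Tate χ, Kramer parity}).
[cite: MazurRubin2010, Cor. 3.4 (i) with Thm. 2.7] [cite: MilneADT2006, I Thm. 4.10] -/
theorem natCard_selmerGroup_twin_eq_two_iff_not_strict_of_duality_of_parity
    (hPT : poitouTate_selmerStructure_duality_real ℚ)
    (hEP : ∀ v : HeightOneSpectrum (𝓞 ℚ), localEulerPoincareCharacteristic (v.adicCompletion ℚ))
    (hKP : MazurRubin2010.kramerParity ℚ) (hsurj : W.HasSurjectiveModNGaloisRep 2)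
    (hΔ : W.Δ < 0) (hK : IsImaginaryQuadratic K) (hodd : Odd (discr K))
    (hH : SatisfiesHeegnerHypothesis (W.conductorNorm ℤ) K) (h2K : ((Ideal.span {(2 : ℤ)}).primesOver (𝓞 K)).ncard = 2)
    {ℓ : ℕ} [Fact ℓ.Prime] (hd : discr K = -(ℓ : ℤ)) (Wd : WeierstrassCurve ℚ) [Wd.IsElliptic]
    (hWd : ∃ C : VariableChange ℚ, C • W.quadraticTwist (discr K : ℚ) = Wd)
    (h4 : Nat.card (W.selmerGroup 2) = 4) :
    Nat.card (Wd.selmerGroup 2) = 2 ↔ ¬ W.selmerGroup 2 ≤ MazurRubin2010.strictLocalKer W ℚ_[ℓ] 2 := by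
  obtain ⟨hstrict, hnot⟩ := cor34i_twin_prime_heegner_of_duality_of_parity W hPT hEP hKP hsurj hΔ hK hodd hH h2K hd Wd hWd
  constructor
  · intro h2 hle
    have h := hstrict hle
    rw [h2, h4] at h
    norm_num at h
  · intro hn
    have h := hnot hn
    rw [h4] at h
    omega

end Summit.BirchSwinnertonDyer.BirchSwinnertonDyer.Theorems.GenusKolyTwin

end
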